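import Summits.QuantumFields.BalabanUV.T4Continuum.Support.NE7ConvOneStepClassPoincare
import Summits.QuantumFields.BalabanUV.T4Continuum.Support.AveragingDeficitMultiLevelBridge
import HarnessLib

/-!
# NE7CriticalSliceAdapter — CRITICALITY ON THE KERNEL OF THE CONSTRAINT's DIFFERENTIAL IS ENOUGH: `dAction U♯ = 0` on the `𝔲(N)` torus fields in
# `ker levelQ'` ⟹ `dAction U♯ = 0` on the block-Landau tangent slice `T_♮(U♯)`, hence CONV-ONE-STEP (F5) and ONE-STEP (F5 §2) from
# «CRIT-ONE-STEP stated on `ker levelQ'`» — the currency of the Lagrange-multiplier form (F8) and of [Balaban1985Variational] (93)∕(141)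

Cell `pub-balaban`, rung (B)+1 sub-cell t4, lineage `b2b-balaban-t4-ne7-p1`, generation 66 (CRUX PROVER NE7 #1); hunt (h10) «ONE-STEP = CRIT ∧ CONV»,
memo `t4/b2b-balaban-t4-ne7-p1-g66/HUNT-H10-TWO-ROADS.md` §2–§3.  File F10 (the junction of F5 `NE7ConvOneStepClassPoincare` with F8 `NE7CriticalMultiplier`).

WHAT ([folklore]; 0 def, 0 sorry).
§1 **`dAction_eq_zero_on_slice_of_ker`** — `U♯` unitary, `(L·tower L N k)`-periodic, `SmallField U♯ x` with `LevelSmall d L k x`; if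
   `dAction U♯ (extDir Φ) W = 0` for every `𝔲(N)` torus field `Φ` with `levelQ' L N k U♯ Φ = 0`, then `dAction U♯ Y W = 0` for every `Y` in
   `frameFreeBlockLandauW L N (k+1) U♯` (a slice member is skew, `tower L N (k+1)`-periodic and `TangentIter L k U♯`; row NE3-R2's
   `AveragingDeficitMultiLevelPrep.levelQ'_resDir_eq_zero` puts its restriction in `ker levelQ'`; `Y = extDir (resDir Y)`).  The slice's two gauge clauses are not used:
   criticality on the kernel of the constraint's differential is criticality on every tangent direction.
§2 **`isMinimiser_of_kerCritical_rep_class`** ∕ **`oneStep_of_kerCritical_rep_class`** — F5's CONV-ONE-STEP ∕ ONE-STEP with the criticality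
   hypothesis in the `ker levelQ'` currency (plus the level smallness `LevelSmall d L k (ε(L^{k+1})^{−2})` of row Y9's family), everything else as in
   F5 (class-level (P♮)_W of row NE3, REP with the two normal letters, one numeric line).  With F8 `NE7CriticalMultiplier.exists_multiplier` the same
   hypothesis is EQUIVALENTLY «`dAction U♯ (extDir Φ) = Λ(levelQ' Φ)` for a linear `Λ`» — the Euler–Lagrange system with a coarse multiplier.
HONEST FRAMING (page 1): bookkeeping over HYPOTHESES; nothing is asserted about Bałaban's minimisers; NOT ONE-STEP, NOT NE7; spine 0∕9; finite T⁴ rung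
(B)+1 — NOT infinite volume, NOT mass gap, NOT Clay.  Continuum YM on T⁴ ⇐ BetaPertH ∧ nine spine estimates (0/9 proved); BetaPertH ⇐ (D1) ∧ (D4) ∧
CAP+tail; G-an2-4 gates asym, D1 and NE2/3/4.
-/

set_option autoImplicit false

open scoped BigOperators Matrix.Norms.L2Operator
open NormedSpace Finset Set

namespace Summit.QuantumFields.BalabanUV.T4Continuum.NE7CriticalSliceAdapter

open Literature.MathematicalPhysics.QuantumFieldTheory.Balaban1983to89
open B7Prop1Explicit B7Prop2Explicit MatrixLog UnitaryModel
open T4AveragingDeficitWall (IsUnitaryCfg IsSkewDir SmallField fineAction vary curl curlSq dirSq)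
open T4AveragingDeficitWallBoundary (IsPeriodicCfg periodBox)
open AveragingDeficitPeriodicCounting (IsPeriodicDir)
open AveragingDeficitTorusChart (TDir extDir resDir extDir_resDir)
open AveragingDeficitTwoLevelPrep (skewSub)
open AveragingDeficitMultiLevelPrep (tower LevelSmall levelQ' natCast_tower_succ levelQ'_resDir_eq_zero)
open AveragingDeficitMultiLevelBridge (tower_eq)
open MinimalActionLevels (levelAction perWin)
open MinimalActionSandwich (IsMinimiser admissible)
open MinimalActionRate (sfClass)
open NE3HessForm (dAction)
open NE3SlicePoincareShape (SlicePoincare)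
open NE3FrameFreeSliceW (frameFreeBlockLandauW)
open NE7InteriorInduction (interior_exists_all_levels hint_of_oneStep)
open NE7ConvOneStepEnd (isMinimiser_of_critical_rep)

noncomputable section

variable {d : ℕ} {n : Type*} [Fintype n] [DecidableEq n]

/-! ## §1 Criticality on `ker levelQ'` gives criticality on the slice -/

/-- **CRITICALITY ON `ker levelQ'` ⟹ CRITICALITY ON `T_♮(U♯)`.**  See the module docstring, §1. [folklore] -/
theorem dAction_eq_zero_on_slice_of_ker [Nonempty n] {L N k : ℕ} [NeZero L] [NeZero N] (hL : 1 ≤ L)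
    {Us : Site d → Fin d → (Matrix n n ℂ)ˣ} {x : ℝ} (hUs : IsUnitaryCfg Us) (hUsP : IsPeriodicCfg Us ((L : ℤ) * (tower L N k : ℕ)))
    (hx : 0 ≤ x) (hls : LevelSmall d L k x) (hUsx : SmallField Us x) (W : Finset (T4AveragingDeficitWall.Plaq d))
    (hcritK : ∀ Φ : TDir d n (L * tower L N k), (∀ r κ, Φ r κ ∈ skewAdjoint (Matrix n n ℂ)) →
      levelQ' L N k Us Φ = 0 → dAction Us (extDir (L * tower L N k) Φ) W = 0) :
    ∀ Y ∈ frameFreeBlockLandauW (d := d) (n := n) L N (k + 1) Us, dAction Us Y W = 0 := by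
  haveI : NeZero (L * tower L N k) := ⟨Nat.mul_ne_zero (NeZero.ne L) (AveragingDeficitMultiLevelPrep.tower_ne_zero L N k)⟩
  intro Y hY
  obtain ⟨hYs, hYP, hYT, -, -⟩ := hY
  -- the slice's period `tower L N (k+1) = L · tower L N k`
  have hYP' : IsPeriodicDir Y ((L * tower L N k : ℕ) : ℤ) := by
    have e : ((tower L N (k + 1) : ℕ) : ℤ) = ((L * tower L N k : ℕ) : ℤ) := by rw [natCast_tower_succ]; push_cast; ring
    rw [← e]; exact hYP
  have hYT' : AveragingDeficitMultiLevelPrep.TangentIter L k Us Y := by simpa using hYT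
  have hker : levelQ' L N k Us (resDir (L * tower L N k) Y) = 0 := levelQ'_resDir_eq_zero hL k hUs hUsP hx hls hUsx hYP' hYT'
  have hres : ∀ r κ, resDir (L * tower L N k) Y r κ ∈ skewAdjoint (Matrix n n ℂ) := fun r κ => hYs _ _
  have h := hcritK (resDir (L * tower L N k) Y) hres hker
  rwa [extDir_resDir (L * tower L N k) hYP'] at h

/-! ## §2 CONV-ONE-STEP and ONE-STEP with criticality in the `ker levelQ'` currency -/

/-- **CONV-ONE-STEP ON `T_♮(U♯)` FROM CRITICALITY ON `ker levelQ'`** (F5's `isMinimiser_of_critical_rep_class` with §1; `L ≥ 1`, `N ≥ 1`, `ε ≥ 0`,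
`LevelSmall d L k (ε(L^{k+1})^{−2})`). [folklore] -/
theorem isMinimiser_of_kerCritical_rep_class [Nonempty n] {L N k : ℕ} [NeZero L] [NeZero N] (hL : 1 ≤ L) (hN : 1 ≤ N) {ε CP : ℝ}
    (hε : 0 ≤ ε) (hCP : 0 < CP) (hls : LevelSmall d L k (ε / ((L : ℝ) ^ (k + 1)) ^ 2))
    (hP : ∀ (j : ℕ) (W : Site d → Fin d → (Matrix n n ℂ)ˣ), W ∈ sfClass d L N ε (j + 1) →
      SlicePoincare L (j + 1) W (frameFreeBlockLandauW L N (j + 1) W) CP (periodBox (d := d) (N * L ^ (j + 1))))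
    {V Us : Site d → Fin d → (Matrix n n ℂ)ˣ} (hmem : Us ∈ admissible (sfClass d L N ε) L (k + 1) V)
    (hcritK : ∀ Φ : TDir d n (L * tower L N k), (∀ r κ, Φ r κ ∈ skewAdjoint (Matrix n n ℂ)) →
      levelQ' L N k Us Φ = 0 → dAction Us (extDir (L * tower L N k) Φ) (perWin d (N * L ^ (k + 1))) = 0)
    (hrep : ∀ U' ∈ admissible (sfClass d L N ε) L (k + 1) V, ∃ (X XT XN : Site d → Fin d → Matrix n n ℂ) (α θ CN : ℝ),
      IsSkewDir X ∧ IsPeriodicDir X ((N * L ^ (k + 1) : ℕ) : ℤ) ∧ 0 ≤ α ∧ (∀ x μ, ‖X x μ‖ ≤ α) ∧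
      levelAction d L N (k + 1) (vary Us X 1) ≤ levelAction d L N (k + 1) U' ∧
      SmallField (vary Us X 1) (ε / ((L : ℝ) ^ (k + 1)) ^ 2) ∧
      X = XT + XN ∧ XT ∈ frameFreeBlockLandauW (d := d) (n := n) L N (k + 1) Us ∧ IsSkewDir XN ∧
      IsPeriodicDir XN ((N * L ^ (k + 1) : ℕ) : ℤ) ∧
      dirSq XN (periodBox (d := d) (N * L ^ (k + 1))) ≤ θ * dirSq X (periodBox (d := d) (N * L ^ (k + 1))) ∧
      (∑ p ∈ perWin d (N * L ^ (k + 1)), ‖curl Us XN p‖) ≤ CN * dirSq X (periodBox (d := d) (N * L ^ (k + 1))) ∧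
      2 * (ε / ((L : ℝ) ^ (k + 1)) ^ 2 * CN)
        ≤ (((((((L : ℝ) ^ (k + 1))⁻¹) ^ 2 / CP) / 4 - (((((L : ℝ) ^ (k + 1))⁻¹) ^ 2 / CP) / 2 + 16 * d) * θ) / 2
            - 576 * d * (Real.exp α - 1) ^ 2) / (Fintype.card n : ℝ) - 28 * d * (ε / ((L : ℝ) ^ (k + 1)) ^ 2 + 7 * α ^ 2))) :
    IsMinimiser d (sfClass d L N ε) L N (k + 1) V Us := by
  have ha : 0 ≤ ε / ((L : ℝ) ^ (k + 1)) ^ 2 := by positivity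
  have hUsP : IsPeriodicCfg Us ((L : ℤ) * (tower L N k : ℕ)) := by
    have e : ((N * L ^ (k + 1) : ℕ) : ℤ) = (L : ℤ) * (tower L N k : ℕ) := by rw [tower_eq]; push_cast; ring
    rw [← e]; exact hmem.1.2.1
  have hcrit := dAction_eq_zero_on_slice_of_ker hL hmem.1.1 hUsP ha hls hmem.1.2.2 (perWin d (N * L ^ (k + 1))) hcritK
  exact isMinimiser_of_critical_rep hL hN hmem hmem.1.1 ha hmem.1.2.2 hCP (hP k Us hmem.1) hcrit hrep

/-- **ONE-STEP FROM «CRIT-ONE-STEP ON `ker levelQ'` + REP» GIVEN (P♮)_W AND THE LEVEL SMALLNESS FAMILY** (the `hstep` binder of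
`NE7InteriorInduction.interior_exists_all_levels`). [folklore] -/
theorem oneStep_of_kerCritical_rep_class [Nonempty n] {L N : ℕ} [NeZero L] [NeZero N] (hL : 1 ≤ L) (hN : 1 ≤ N) {ε δ CP : ℝ}
    (hε : 0 ≤ ε) (hCP : 0 < CP) (hls : ∀ k : ℕ, LevelSmall d L k (ε / ((L : ℝ) ^ (k + 1)) ^ 2))
    (hP : ∀ (j : ℕ) (W : Site d → Fin d → (Matrix n n ℂ)ˣ), W ∈ sfClass d L N ε (j + 1) →
      SlicePoincare L (j + 1) W (frameFreeBlockLandauW L N (j + 1) W) CP (periodBox (d := d) (N * L ^ (j + 1))))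
    {V : Site d → Fin d → (Matrix n n ℂ)ˣ}
    (hcrit : ∀ (k : ℕ) (U₀ : Site d → Fin d → (Matrix n n ℂ)ˣ), U₀ ∈ admissible (sfClass d L N ε) L (k + 1) V →
      SmallField U₀ (δ / ((L : ℝ) ^ k) ^ 2) →
      ∃ Us : Site d → Fin d → (Matrix n n ℂ)ˣ, Us ∈ admissible (sfClass d L N ε) L (k + 1) V ∧ SmallField Us (δ / ((L : ℝ) ^ (k + 1)) ^ 2) ∧
        (∀ Φ : TDir d n (L * tower L N k), (∀ r κ, Φ r κ ∈ skewAdjoint (Matrix n n ℂ)) →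
          levelQ' L N k Us Φ = 0 → dAction Us (extDir (L * tower L N k) Φ) (perWin d (N * L ^ (k + 1))) = 0) ∧
        ∀ U' ∈ admissible (sfClass d L N ε) L (k + 1) V, ∃ (X XT XN : Site d → Fin d → Matrix n n ℂ) (α θ CN : ℝ),
          IsSkewDir X ∧ IsPeriodicDir X ((N * L ^ (k + 1) : ℕ) : ℤ) ∧ 0 ≤ α ∧ (∀ x μ, ‖X x μ‖ ≤ α) ∧
          levelAction d L N (k + 1) (vary Us X 1) ≤ levelAction d L N (k + 1) U' ∧
          SmallField (vary Us X 1) (ε / ((L : ℝ) ^ (k + 1)) ^ 2) ∧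
          X = XT + XN ∧ XT ∈ frameFreeBlockLandauW (d := d) (n := n) L N (k + 1) Us ∧ IsSkewDir XN ∧
          IsPeriodicDir XN ((N * L ^ (k + 1) : ℕ) : ℤ) ∧
          dirSq XN (periodBox (d := d) (N * L ^ (k + 1))) ≤ θ * dirSq X (periodBox (d := d) (N * L ^ (k + 1))) ∧
          (∑ p ∈ perWin d (N * L ^ (k + 1)), ‖curl Us XN p‖) ≤ CN * dirSq X (periodBox (d := d) (N * L ^ (k + 1))) ∧
          2 * (ε / ((L : ℝ) ^ (k + 1)) ^ 2 * CN)
            ≤ (((((((L : ℝ) ^ (k + 1))⁻¹) ^ 2 / CP) / 4 - (((((L : ℝ) ^ (k + 1))⁻¹) ^ 2 / CP) / 2 + 16 * d) * θ) / 2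
                - 576 * d * (Real.exp α - 1) ^ 2) / (Fintype.card n : ℝ) - 28 * d * (ε / ((L : ℝ) ^ (k + 1)) ^ 2 + 7 * α ^ 2))) :
    ∀ (k : ℕ) (U₀ : Site d → Fin d → (Matrix n n ℂ)ˣ), U₀ ∈ admissible (sfClass d L N ε) L (k + 1) V →
      SmallField U₀ (δ / ((L : ℝ) ^ k) ^ 2) →
      ∃ U, IsMinimiser d (sfClass d L N ε) L N (k + 1) V U ∧ SmallField U (δ / ((L : ℝ) ^ (k + 1)) ^ 2) := by
  intro k U₀ hU₀ hU₀a
  obtain ⟨Us, hmem, hUsδ, hcr, hrep⟩ := hcrit k U₀ hU₀ hU₀a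
  exact ⟨Us, isMinimiser_of_kerCritical_rep_class hL hN hε hCP (hls k) hP hmem hcr hrep, hUsδ⟩

end

end Summit.QuantumFields.BalabanUV.T4Continuum.NE7CriticalSliceAdapter
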